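import Mathlib
import Summits.QuantumFields.YangMills.Theorems.FlatTubeReductionGroundStateConcentration
import HarnessLib

/-!
# Real arithmetic of the two-layer onion at a POLYNOMIAL radius `β^{−p}`: target mass `β^{−1/2}·‖Ω‖²`
# (route `TransportFieldFano`, LINE g17-A, crux ⟨stmt-QuantumFields-23353⟩ `MeanLoopCeilingWeak` helper lane; companion of
# `…TransportFieldFanoVacuumConcentrationRpow`, which runs FTR's two-layer onion ✓`GroundConc.layer_mass_le` at the radius `β^{−p}`,
# `0 < p < 1/5`, of RED's record valley gain ✓`TwoLattice.ConstTube.valleyGain_record` instead of `β^{−1/39}`)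

FTR's ✓`GroundConc.two_layer_arith` / ✓`GroundConc.endgame_real` (file `…FlatTubeReductionGroundStateOnionArith`) are typed for the radius
`ρ = β^{−1/39}` and the target `‖Ω‖²/β`.  At radius `ρ = β^{−p}` the IMS defect of one layer is `≍ ρ^{−2}β^{−1}/λ_b(L³β) ≍ β^{2p−2/3}` relative to
the mass it is paid on, so two layers give `β^{4p−4/3}`, which is `≤ β^{−1/2}/2` eventually exactly when `p < 5/24`; the record valley gain reaches
`p < 1/5 < 5/24`.  This file re-types the two arithmetic lemmas with the target `θ·‖Ω‖²`, `θ = β^{−1/2}`: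
* `two_layer_arith_gen` — the two-layer bookkeeping with a general target `θ·N` (hypotheses `(a e₁)(a e₂) ≤ θ/2`, `a e₂ ≤ 1`, the three
  super-polynomially small terms `≤ θ/16`);
* `endgame_real_rpow` — the five smallness conditions at `ρ = β^{−p}` from the scale relations `u = c_L β^{−1/3}`, `η = β^{−17/20}`, `γ ≥ u/2`,
  `λ₀ ≥ f·c_β^{|E|}` and five eventual inequalities (`2(K₀/c_L)² + 4 ≤ β^{5/6−4p}/2`, `K₀/c_L + 4 ≤ β^{2/3−2p}/2`, and three stretched-exponential
  ones), with `(a e₁)(a e₂) ≤ β^{−1/2}/2` and the three small terms `≤ 1/(16β) ≤ β^{−1/2}/16`.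
HONEST FRAMING: pure real arithmetic (helper for a fixed-lattice concentration estimate); nothing about infinite volume, the continuum or the
Yang–Mills mass gap; no summit statement.  No `sorry`, no new definition, no named-fact hypothesis.
References: [cite: SimonB1983DiscreteSpectrum, §3]; [cite: Luscher1983, §2–3].
-/

set_option autoImplicit false

noncomputable section

open Real

namespace Summit.QuantumFields.YangMills.Theorems.TransportFieldFano

namespace VacuumConc

/-! ## §1 Two layers with a general target `θ·N` -/

/-- Pure arithmetic of the two-layer onion with target `θ·N`: if `X₁ ≤ a(cb·N + e₁N + kN) + tN`, `X₂ ≤ a(cb·N + e₂X₁ + kN) + tN`,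
`(a e₁)(a e₂) ≤ θ/2`, `a e₂ ≤ 1` and `a·cb, a·k, t ≤ θ/16`, then `X₂ ≤ θ·N`. [folklore] -/
theorem two_layer_arith_gen {N X₁ X₂ a cb e₁ e₂ k t θ : ℝ} (hN : 0 ≤ N) (hθ : 0 ≤ θ)
    (ha : 0 ≤ a) (hcb : 0 ≤ cb) (he₂ : 0 ≤ e₂) (hk : 0 ≤ k) (ht : 0 ≤ t)
    (hX1 : X₁ ≤ a * (cb * N + e₁ * N + k * N) + t * N)
    (hX2 : X₂ ≤ a * (cb * N + e₂ * X₁ + k * N) + t * N)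
    (hmain : (a * e₁) * (a * e₂) ≤ θ / 2) (he₂' : a * e₂ ≤ 1)
    (hcb' : a * cb ≤ θ / 16) (hk' : a * k ≤ θ / 16) (ht' : t ≤ θ / 16) :
    X₂ ≤ θ * N := by
  have hae₂ : 0 ≤ a * e₂ := mul_nonneg ha he₂
  have h1 : a * e₂ * X₁ ≤ a * e₂ * (a * (cb * N + e₁ * N + k * N) + t * N) := mul_le_mul_of_nonneg_left hX1 hae₂
  have h2 : a * e₂ * (a * (cb * N + e₁ * N + k * N) + t * N)
      = ((a * e₁) * (a * e₂)) * N + (a * e₂) * ((a * cb + a * k + t) * N) := by ring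
  have h3 : (a * e₂) * ((a * cb + a * k + t) * N) ≤ 1 * ((a * cb + a * k + t) * N) :=
    mul_le_mul_of_nonneg_right he₂' (by positivity)
  have h4 : ((a * e₁) * (a * e₂)) * N ≤ θ / 2 * N := mul_le_mul_of_nonneg_right hmain hN
  have h5 : (a * cb + a * k + t) * N ≤ (3 * θ / 16) * N := by
    refine mul_le_mul_of_nonneg_right ?_ hN
    linarith
  have h6 : X₂ ≤ (a * cb + a * k + t) * N + a * e₂ * X₁ := by nlinarith [hX2]
  have h7 : (θ / 2 + 2 * (3 * θ / 16)) * N ≤ θ * N := by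
    have hθN : 0 ≤ θ * N := mul_nonneg hθ hN
    nlinarith
  nlinarith [h1, h2, h3, h4, h5, h6, h7]

/-! ## §2 The endgame at radius `ρ = β^{−p}` -/

set_option maxHeartbeats 800000 in
/-- The real-arithmetic ENDGAME of the two-layer onion at radius `ρ = β^{−p}` with target `β^{−1/2}`: the five smallness conditions of
`two_layer_arith_gen` from `u = c_L β^{−1/3}`, `ρ = β^{−p}`, `η = β^{−17/20}`, `γ ≥ u/2`, `λ₀ ≥ f·c_β^{|E|}`, the cross-copy bound
`cb ≤ (4/w)^n β^{2n} e^{−β^{1−2p}/(8n)} c_β^{|E|}` and five eventual inequalities (the first needs `p < 5/24`). [folklore] -/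
theorem endgame_real_rpow (n : ℕ) {β f w lat lam u cL ρ η γ L3 cb p : ℝ}
    (hβ1 : 1 ≤ β) (hn : 0 < (n : ℝ)) (hf : 0 < f) (hw : 0 < w) (hlat : 0 < lat) (hlamf : f * lat ≤ lam)
    (hu0 : 0 < u) (hcL : 0 < cL) (hu : u = cL * β ^ (-(1 : ℝ) / 3)) (hL3 : 0 < L3) (hinvu : 1 / u ≤ L3 * β)
    (hρ : ρ = β ^ (-p)) (hη : η = β ^ (-(17 / 20 : ℝ))) (hγu : u / 2 ≤ γ)
    (hcb0 : 0 ≤ cb) (hcb : cb ≤ (4 / w) ^ n * β ^ (2 * n) * Real.exp (-(1 / (8 * n) * β ^ (1 - 2 * p))) * lat)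
    (h1 : 2 * ((6 * (n : ℝ) ^ 2 * (8 * π) ^ 2 / f) / cL) ^ 2 + 4 ≤ β ^ (5 / 6 - 4 * p) / 2)
    (h2 : (6 * (n : ℝ) ^ 2 * (8 * π) ^ 2 / f) / cL + 4 ≤ β ^ (2 / 3 - 2 * p) / 2)
    (h3 : 16 * (4 * L3 / f) * (4 / w) ^ n * β ^ (2 * n + 2) * Real.exp (-(1 / (8 * n) * β ^ (1 - 2 * p))) ≤ 1)
    (h4 : 16 * (4 * L3 / f) * (1 + 4 * L3) * β ^ 3 * Real.exp (-(β ^ ((3 : ℝ) / 20))) ≤ 1)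
    (h5 : 16 / f * β * Real.exp (-(β ^ ((3 : ℝ) / 20))) ≤ 1) :
    (2 / (γ * lam) * ((1 / 2) * ((n : ℝ) ^ 2 * (8 * π / ρ) ^ 2 * (3 / β) * lat))) *
        (2 / (γ * lam) * ((1 / 2) * ((n : ℝ) ^ 2 * (8 * π / (3 * ρ)) ^ 2 * (3 / β) * lat))) ≤ β ^ (-(1 : ℝ) / 2) / 2 ∧
      2 / (γ * lam) * ((1 / 2) * ((n : ℝ) ^ 2 * (8 * π / (3 * ρ)) ^ 2 * (3 / β) * lat)) ≤ 1 ∧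
      2 / (γ * lam) * cb ≤ 1 / (16 * β) ∧
      2 / (γ * lam) * ((1 + 2 / γ) * (Real.exp (-(β * η)) * lat)) ≤ 1 / (16 * β) ∧
      Real.exp (-(β * η)) * lat / lam ≤ 1 / (16 * β) := by
  have hβ0 : 0 < β := by linarith
  have hββ : ∀ x : ℝ, β * β ^ x = β ^ (1 + x) := fun x => by rw [Real.rpow_add hβ0, Real.rpow_one]
  have hρ0 : 0 < ρ := by rw [hρ]; exact Real.rpow_pos_of_pos hβ0 _
  have h3ρ0 : 0 < 3 * ρ := by positivity
  have hγ0 : 0 < γ := by linarith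
  have hlam0 : 0 < lam := lt_of_lt_of_le (by positivity) hlamf
  set K₀ : ℝ := 6 * (n : ℝ) ^ 2 * (8 * π) ^ 2 / f with hK₀
  have hK₀0 : 0 < K₀ := by positivity
  set a : ℝ := 2 / (γ * lam) with hadef
  have ha0 : 0 ≤ a := by positivity
  set e₁ : ℝ := (1 / 2) * ((n : ℝ) ^ 2 * (8 * π / ρ) ^ 2 * (3 / β) * lat) with he₁
  set e₂ : ℝ := (1 / 2) * ((n : ℝ) ^ 2 * (8 * π / (3 * ρ)) ^ 2 * (3 / β) * lat) with he₂
  have he₂0 : 0 ≤ e₂ := by positivity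
  have he₂1 : e₂ ≤ e₁ := by
    rw [he₁, he₂]
    have h1 : 8 * π / (3 * ρ) ≤ 8 * π / ρ := div_le_div_of_nonneg_left (by positivity) hρ0 (by linarith)
    gcongr
  -- `a ≤ 4/(u f lat)`
  have ha_le : a ≤ 4 / (u * (f * lat)) := by
    rw [hadef, div_le_div_iff₀ (by positivity) (by positivity)]
    have : u * (f * lat) ≤ (2 * γ) * lam := mul_le_mul (by linarith only [hγu]) hlamf (by positivity) (by positivity)
    linarith only [this]
  -- the key quantity `A = K₀/(uρ²β) = (K₀/cL)·β^{−(2/3 − 2p)}`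
  set s : ℝ := 2 / 3 - 2 * p with hs
  have hM : u * ρ ^ 2 * β = cL * β ^ s := by
    have hex : s = -(1 : ℝ) / 3 + (-p * ((2 : ℕ) : ℝ)) + 1 := by rw [hs]; push_cast; ring
    rw [hu, hρ, ← Real.rpow_mul_natCast hβ0.le, hex, Real.rpow_add hβ0, Real.rpow_add hβ0, Real.rpow_one]
    ring
  have hM0 : 0 < u * ρ ^ 2 * β := by positivity
  have hβs0 : 0 < β ^ s := Real.rpow_pos_of_pos hβ0 _
  have hae : a * e₁ ≤ K₀ / (u * ρ ^ 2 * β) := by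
    calc a * e₁ ≤ 4 / (u * (f * lat)) * e₁ := mul_le_mul_of_nonneg_right ha_le (by positivity)
      _ = K₀ / (u * ρ ^ 2 * β) := by
          rw [he₁, hK₀]
          field_simp
          ring
  -- `A² ≤ β^{−1/2}/2`
  have hAsq : (K₀ / (u * ρ ^ 2 * β)) ^ 2 ≤ β ^ (-(1 : ℝ) / 2) / 2 := by
    rw [hM]
    have hβa : 2 * (K₀ / cL) ^ 2 ≤ β ^ (5 / 6 - 4 * p) := by
      have h' := (le_div_iff₀ (by norm_num : (0 : ℝ) < 2)).1 h1
      have hb0 : 0 ≤ β ^ (5 / 6 - 4 * p) := Real.rpow_nonneg hβ0.le _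
      nlinarith [sq_nonneg (K₀ / cL)]
    -- `β^{5/6 − 4p} = (β^s)² · β^{−1/2}`
    have e2 : β ^ (5 / 6 - 4 * p) = (β ^ s) ^ 2 * β ^ (-(1 : ℝ) / 2) := by
      have hex : (5 : ℝ) / 6 - 4 * p = s * ((2 : ℕ) : ℝ) + -(1 : ℝ) / 2 := by rw [hs]; push_cast; ring
      rw [hex, Real.rpow_add hβ0, Real.rpow_mul_natCast hβ0.le]
    rw [e2] at hβa
    rw [div_pow, mul_pow]
    rw [div_le_div_iff₀ (by positivity) (by norm_num)]
    have hc2 : 0 < cL ^ 2 := by positivity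
    have h3 : 2 * K₀ ^ 2 ≤ cL ^ 2 * ((β ^ s) ^ 2 * β ^ (-(1 : ℝ) / 2)) := by
      have h4 := mul_le_mul_of_nonneg_left hβa hc2.le
      have e3 : cL ^ 2 * (2 * (K₀ / cL) ^ 2) = 2 * K₀ ^ 2 := by field_simp
      rw [e3] at h4
      exact h4
    have e4 : β ^ (-(1 : ℝ) / 2) * (cL ^ 2 * (β ^ s) ^ 2) = cL ^ 2 * ((β ^ s) ^ 2 * β ^ (-(1 : ℝ) / 2)) := by ring
    rw [e4]
    linarith [h3]
  have hA1 : K₀ / (u * ρ ^ 2 * β) ≤ 1 := by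
    rw [hM, div_le_one (by positivity)]
    have h' := (le_div_iff₀ (by norm_num : (0 : ℝ) < 2)).1 h2
    have hKc : 0 ≤ K₀ / cL := by positivity
    have hβa : K₀ / cL ≤ β ^ s := by rw [hs]; exact le_trans (by linarith) h'
    rw [div_le_iff₀ hcL] at hβa
    linarith [hβa]
  have hmain : (a * e₁) * (a * e₂) ≤ β ^ (-(1 : ℝ) / 2) / 2 := by
    have h1 : a * e₂ ≤ a * e₁ := mul_le_mul_of_nonneg_left he₂1 ha0
    have h2 : 0 ≤ a * e₂ := mul_nonneg ha0 he₂0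
    calc (a * e₁) * (a * e₂) ≤ (K₀ / (u * ρ ^ 2 * β)) * (K₀ / (u * ρ ^ 2 * β)) :=
          mul_le_mul hae (h1.trans hae) h2 ((h2.trans h1).trans hae)
      _ = (K₀ / (u * ρ ^ 2 * β)) ^ 2 := (sq _).symm
      _ ≤ β ^ (-(1 : ℝ) / 2) / 2 := hAsq
  have he₂' : a * e₂ ≤ 1 := ((mul_le_mul_of_nonneg_left he₂1 ha0).trans hae).trans hA1
  -- the super-polynomially small terms
  have hexp2 : β * η = β ^ ((3 : ℝ) / 20) := by rw [hη, hββ]; norm_num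
  have hcb' : a * cb ≤ 1 / (16 * β) := by
    set X : ℝ := (4 / w) ^ n * β ^ (2 * n) * Real.exp (-(1 / (8 * n) * β ^ (1 - 2 * p))) with hX
    have hX0 : 0 ≤ X := by positivity
    have h1 : a * cb ≤ 4 / (u * (f * lat)) * (X * lat) := mul_le_mul ha_le hcb hcb0 (by positivity)
    have h2 : 4 / (u * (f * lat)) * (X * lat) = (4 * (1 / u) / f) * X := by field_simp
    rw [h2] at h1
    have h3' : 4 * (1 / u) / f ≤ 4 * (L3 * β) / f := div_le_div_of_nonneg_right (by linarith only [hinvu]) hf.le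
    have h4' : a * cb ≤ 4 * (L3 * β) / f * X := h1.trans (mul_le_mul_of_nonneg_right h3' hX0)
    rw [le_div_iff₀ (by positivity)]
    have h5' : a * cb * (16 * β) ≤ 4 * (L3 * β) / f * X * (16 * β) := mul_le_mul_of_nonneg_right h4' (by positivity)
    have e : 16 * (4 * L3 / f) * (4 / w) ^ n * β ^ (2 * n + 2) * Real.exp (-(1 / (8 * n) * β ^ (1 - 2 * p)))
        = 4 * (L3 * β) / f * X * (16 * β) := by
      rw [hX, pow_add]; ring
    rw [e] at h3
    exact h5'.trans h3
  have hk' : a * ((1 + 2 / γ) * (Real.exp (-(β * η)) * lat)) ≤ 1 / (16 * β) := by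
    have hγ' : 2 / γ ≤ 4 * (1 / u) := by
      rw [div_le_iff₀ hγ0]
      have e : 4 * (1 / u) * γ = 4 * γ / u := by ring
      rw [e, le_div_iff₀ hu0]; linarith
    have hE0 : 0 < Real.exp (-(β * η)) := Real.exp_pos _
    have h1 : (1 + 2 / γ) * (Real.exp (-(β * η)) * lat) ≤ (1 + 4 * (1 / u)) * (Real.exp (-(β * η)) * lat) :=
      mul_le_mul_of_nonneg_right (by linarith only [hγ']) (by positivity)
    have h2 : a * ((1 + 2 / γ) * (Real.exp (-(β * η)) * lat)) ≤ 4 / (u * (f * lat)) * ((1 + 4 * (1 / u)) * (Real.exp (-(β * η)) * lat)) :=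
      mul_le_mul ha_le h1 (by positivity) (by positivity)
    have h3' : 4 / (u * (f * lat)) * ((1 + 4 * (1 / u)) * (Real.exp (-(β * η)) * lat))
        = 4 * (1 / u) / f * (1 + 4 * (1 / u)) * Real.exp (-(β * η)) := by field_simp
    rw [h3'] at h2
    have h4' : 4 * (1 / u) / f * (1 + 4 * (1 / u)) ≤ 4 * (L3 * β) / f * (1 + 4 * (L3 * β)) :=
      mul_le_mul (div_le_div_of_nonneg_right (by linarith only [hinvu]) hf.le) (by linarith only [hinvu]) (by positivity)
        (by positivity)
    have h5' : 4 * (L3 * β) / f * (1 + 4 * (L3 * β)) ≤ (4 * L3 / f) * (1 + 4 * L3) * β ^ 2 := by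
      have hb : 1 + 4 * (L3 * β) ≤ (1 + 4 * L3) * β := by
        have e' : (1 + 4 * L3) * β = β + 4 * (L3 * β) := by ring
        rw [e']; linarith only [hβ1]
      have e : 4 * (L3 * β) / f * ((1 + 4 * L3) * β) = (4 * L3 / f) * (1 + 4 * L3) * β ^ 2 := by ring
      rw [← e]; exact mul_le_mul_of_nonneg_left hb (by positivity)
    have h6 : a * ((1 + 2 / γ) * (Real.exp (-(β * η)) * lat)) ≤ (4 * L3 / f) * (1 + 4 * L3) * β ^ 2 * Real.exp (-(β * η)) :=
      h2.trans (mul_le_mul_of_nonneg_right (h4'.trans h5') hE0.le)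
    have h4'' : 16 * (4 * L3 / f) * (1 + 4 * L3) * β ^ 3 * Real.exp (-(β * η)) ≤ 1 := by rw [hexp2]; exact h4
    rw [le_div_iff₀ (by positivity)]
    have h7 := mul_le_mul_of_nonneg_right h6 (show (0 : ℝ) ≤ 16 * β by positivity)
    have e : (4 * L3 / f) * (1 + 4 * L3) * β ^ 2 * Real.exp (-(β * η)) * (16 * β)
        = 16 * (4 * L3 / f) * (1 + 4 * L3) * β ^ 3 * Real.exp (-(β * η)) := by ring
    generalize Real.exp (-(β * η)) = X at h7 e h4'' ⊢
    linarith [h7, e, h4'']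
  have ht' : Real.exp (-(β * η)) * lat / lam ≤ 1 / (16 * β) := by
    have h1 : Real.exp (-(β * η)) * lat / lam ≤ Real.exp (-(β * η)) * lat / (f * lat) :=
      div_le_div_of_nonneg_left (by positivity) (by positivity) hlamf
    have h2 : Real.exp (-(β * η)) * lat / (f * lat) = Real.exp (-(β ^ ((3 : ℝ) / 20))) / f := by
      rw [hexp2]; field_simp
    rw [h2] at h1
    rw [le_div_iff₀ (by positivity)]
    have h3' := mul_le_mul_of_nonneg_right h1 (show (0 : ℝ) ≤ 16 * β by positivity)
    have e : Real.exp (-(β ^ ((3 : ℝ) / 20))) / f * (16 * β) = 16 / f * β * Real.exp (-(β ^ ((3 : ℝ) / 20))) := by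
      field_simp
    generalize Real.exp (-(β ^ ((3 : ℝ) / 20))) = X at h3' e h5 ⊢
    linarith [h3', e, h5]
  exact ⟨hmain, he₂', hcb', hk', ht'⟩

end VacuumConc

end Summit.QuantumFields.YangMills.Theorems.TransportFieldFano

end
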